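import Summits.CriticalPhenomena.PercolationContinuityZ3.Theorems.FK.InfiniteVolumeDLRDefs
import HarnessLib

/-!
# FK-continuity cell, FO-10a: locality of the bad event `D_m(Λ)` of Lemma (4.39) with an EXPLICIT coordinate set,
# and finite configurations are off it

Registered R75 (cell INBOX l.5563, 2026-08-23); registry row FO-10a-g335d; label DLS-A (coordinator fk-4 g153).
Cell `fk-continuity` (bschramm), row FO-10a; support file for the FK-continuity transplant
(`--supports stmt-CriticalPhenomena-4575`); builds on p205010 (kernel theorem, internal audit signed; external expert
review pending). Pure proofs; no definitions, no named facts, no sorries. Bookkeeping for `DLRKernelSandwich.lean`: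
FO-06b-6 records that `D_m(Λ) = regionBadEvent Λ m` is a LOCAL event (`isLocalEvent_regionBadEvent`, an `∃` over the
coordinate set); the finite sandwich of FO-06a needs the set itself, disjoint from `E_Λ`:

* `determinedBy_cylEvent`, `determinedBy_openConnVia_withinGraph_box`, `determinedBy_exitsBox`,
  **`determinedBy_regionBadEvent`** — `D_m(Λ)` is determined by the pairs of `Λ_{m+1}` off `E_Λ`;
* `exists_edge_mem_of_reachable_ne`, **`coe_notMem_regionBadEvent_of_subset_sym2`** — a configuration all of whose pairs lie
  in `Λ_m²` is off `D_m(Λ)` (`Λ ⊆ Λ_m`): no open path leaves `Λ_m`.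

## References

* G. Grimmett, *The Random-Cluster Model*, Springer 2006: Lemma (4.39) eqs. (4.40)–(4.42) [PDF p. 83]. [Grimmett2006]
-/

noncomputable section

open MeasureTheory Set Filter
open scoped Topology ENNReal

namespace Summit.CriticalPhenomena.PercolationContinuityZ3.Theorems.FK

open Literature.Probability.Percolation Literature.Probability.LatticeModels

variable {d : ℕ}

/-! ### Locality of the bad event, with an explicit set of coordinates -/

section Locality

/-- The cylinder event `cylEvent E₀ S` is determined by `E₀`. [folklore] -/
theorem determinedBy_cylEvent {ι : Type*} (E₀ S : Finset ι) : DeterminedBy (cylEvent E₀ S) ↑E₀ := by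
  rw [determinedBy_iff]
  intro ω ω' h
  simp only [mem_cylEvent_iff]
  refine forall₂_congr fun i hi => ?_
  have := Set.ext_iff.1 h i
  simp only [Set.mem_inter_iff, Finset.mem_coe, hi, and_true] at this
  rw [this]

/-- `{x ↔ y via the pairs of Λ_k}` is determined by the pairs of `Λ_k`. [folklore] -/
theorem determinedBy_openConnVia_withinGraph_box (k : ℕ) (x y : Site d) :
    DeterminedBy (openConnVia (withinGraph ⊤ (↑(box d k) : Set (Site d))) x y) ↑((box d k).sym2) := by
  refine (determinedBy_openConnVia _ x y).mono fun e he => ?_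
  induction e using Sym2.ind with
  | _ u v =>
    have h := mem_edgeSet_withinGraph.1 he
    rw [Finset.mem_coe, Finset.mk_mem_sym2_iff]
    exact ⟨h.2.1, h.2.2⟩

/-- The exit event `exitsBox d m z` is determined by the pairs of `Λ_{m+1}`. [folklore] -/
theorem determinedBy_exitsBox (m : ℕ) (z : Site d) : DeterminedBy (exitsBox d m z) ↑((box d (m + 1)).sym2) := by
  rw [determinedBy_iff]
  intro ω ω' h
  simp only [mem_exitsBox_iff]
  refine exists_congr fun c => and_congr_right fun _ => and_congr_right fun _ => ?_
  exact (determinedBy_iff _ _).1 (determinedBy_openConnVia_withinGraph_box (m + 1) z c) ω ω' h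

/-- **`D_m(Λ)` is determined by the pairs of `Λ_{m+1}` off `E_Λ`.** [cite: Grimmett2006, Lemma (4.39) (the events D_{Λ,Δ} are local)] -/
theorem determinedBy_regionBadEvent (Λ : Finset (Site d)) (m : ℕ) :
    DeterminedBy (regionBadEvent Λ m) ↑((box d (m + 1)).sym2 \ edgesIn (zdGraph d) Λ) := by
  classical
  rw [determinedBy_iff]
  intro ω ω' h
  -- the two outside configurations agree on the pairs of `Λ_{m+1}`
  have hout : (ω \ ↑(edgesIn (zdGraph d) Λ)) ∩ ↑((box d (m + 1)).sym2) =
      (ω' \ ↑(edgesIn (zdGraph d) Λ)) ∩ ↑((box d (m + 1)).sym2) := by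
    ext e
    have := Set.ext_iff.1 h e
    simp only [Set.mem_inter_iff, Finset.coe_sdiff, Set.mem_sdiff, Finset.mem_coe] at this ⊢
    tauto
  have hm : (↑((box d m).sym2) : Set (Sym2 (Site d))) ⊆ ↑((box d (m + 1)).sym2) := by
    intro e he
    induction e using Sym2.ind with
    | _ u v =>
      rw [Finset.mem_coe, Finset.mk_mem_sym2_iff] at he ⊢
      exact ⟨box_mono d (Nat.le_succ m) he.1, box_mono d (Nat.le_succ m) he.2⟩
  have houtm : (ω \ ↑(edgesIn (zdGraph d) Λ)) ∩ ↑((box d m).sym2) =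
      (ω' \ ↑(edgesIn (zdGraph d) Λ)) ∩ ↑((box d m).sym2) := by
    rw [← Set.inter_eq_self_of_subset_right hm, ← Set.inter_assoc, ← Set.inter_assoc, hout]
  rw [mem_regionBadEvent_iff, mem_regionBadEvent_iff]
  refine exists_congr fun u => and_congr_right fun _ => exists_congr fun v => and_congr_right fun _ => ?_
  rw [(determinedBy_iff _ _).1 (determinedBy_exitsBox m u) _ _ hout,
    (determinedBy_iff _ _).1 (determinedBy_exitsBox m v) _ _ hout,
    (determinedBy_iff _ _).1 (determinedBy_openConnVia_withinGraph_box m u v) _ _ houtm]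

/-- A vertex reached by an open path of positive length is an endpoint of an open pair. [folklore] -/
theorem exists_edge_mem_of_reachable_ne {V : Type*} {ω : BondConfig V} {u y : V} (h : (openGraph ω).Reachable u y)
    (hne : u ≠ y) : ∃ e ∈ ω, y ∈ e := by
  obtain ⟨w⟩ := h.symm
  cases w with
  | nil => exact (hne rfl).elim
  | @cons _ z _ hadj _ =>
    exact ⟨s(y, z), ((openGraph_adj ω y z).1 hadj).1, Sym2.mem_mk_left y z⟩

/-- **A finite configuration inside `Λ_m²` is off the bad event `D_m(Λ)`** (`Λ ⊆ Λ_m`): no open path leaves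
`Λ_m`. [cite: Grimmett2006, Lemma (4.39)] -/
theorem coe_notMem_regionBadEvent_of_subset_sym2 {Λ : Finset (Site d)} {m : ℕ} (hΛm : Λ ⊆ box d m)
    {ζ : Finset (Sym2 (Site d))} (hζ : ζ ⊆ (box d m).sym2) :
    (↑ζ : BondConfig (Site d)) ∉ regionBadEvent Λ m := by
  rw [mem_regionBadEvent_iff]
  rintro ⟨u, hu, v, -, hexit, -, -⟩
  obtain ⟨c, -, hcm, hconn⟩ := mem_exitsBox_iff.1 hexit
  -- `c` is reached from `u ∈ Λ_m` by an open path of `ζ ∖ E_Λ` (restricted), hence lies in `Λ_m`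
  have hreach : (openGraph (((↑ζ : BondConfig (Site d)) \ ↑(edgesIn (zdGraph d) Λ)) ∩
      (withinGraph ⊤ (↑(box d (m + 1)) : Set (Site d))).edgeSet)).Reachable u c :=
    mem_openClusterIn_iff.1 hconn |>.mono (by rw [openGraph_inter_edgeSet])
  have hne : u ≠ c := by
    rintro rfl
    exact hcm (hΛm hu)
  obtain ⟨e, he, hce⟩ := exists_edge_mem_of_reachable_ne hreach hne
  have heζ : e ∈ ζ := Finset.mem_coe.1 he.1.1
  have := hζ heζ
  induction e using Sym2.ind with
  | _ a b =>
    rw [Finset.mk_mem_sym2_iff] at this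
    rcases Sym2.mem_iff.1 hce with rfl | rfl
    · exact hcm this.1
    · exact hcm this.2

end Locality

end Summit.CriticalPhenomena.PercolationContinuityZ3.Theorems.FK

end
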